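import Summits.QuantumFields.YangMills.Theorems.BalabanUVNodesN12ClassLetterTowerContinuity
import Literature.MathematicalPhysics.QuantumFieldTheory.Balaban1983to89.Node00.MultiScaleFibreChartB
import HarnessLib

/-!
# BalabanUVNodes ∕ N12 — THE CLASS LETTER OF THE w1 LINEAGE's CHART THEOREM, PART 1: CONTINUITY OF THE AVERAGING OF RECORD IN THE CONFIGURATION — **BOND-DATUM EDITION** (`…N12ClassLetterTowerContinuityB`, USED DECLARATIONS ONLY)

The print-datum ([Balaban1984PropagatorsII] (2.3)) (γ) twin of `Summits/…/Theorems/BalabanUVNodesN12ClassLetterTowerContinuity.lean`: the declarations of the parent whose STATEMENT reads the determining datum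
(`continuousOn_constrainedAverages_of_towerGuards`) and which N12's junction of record v14ᴸ uses (dag-n12-c g35 probe-2 census `UsedConstsN12RoadTyped2`, THEOREMS block), re-typed over a
BOND-LEVEL datum `𝔅 : BDetSet` (F0a `B15DeterminingSetsB`) and dag-n12-c's bond-datum chart `Node00.msChartB` (✓p774329; `msChart 𝐁 = msChartB (bondsDet 𝐁)` by `rfl`).  GENERATOR twin
(this seat's `work/g32/gen_thm.py`, block-extracted from the parent's tree bytes): namespace `…N12ClassLetterTowerContinuityB`, SAME short names, `DetSet ↦ BDetSet`, `AgreeOn 𝐁 ↦ AgreeOnB 𝔅`,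
`IsMinimizer ↦ IsMinimizerB`, `bondsOf (𝐁 j) ↦ 𝔅 j`, `msChart ∕ constrCard ∕ constrEnum ∕ ConstrSet ↦ …B`, NODE 00 chart lemmas `…msChart… ↦ …msChartB…`; proofs VERBATIM; the parent's
datum-free declarations REUSED BY NAME (`open`), never copied (private plumbing excepted, №366 R2).  The parent's (b) statements are the instances `𝔅 := bondsDet 𝐁`.

Cell `pub-ymgap` (HUMAN RULINGS D-0062 ∕ D-0149), seat `pub-ymgap-dag-n12-d` g32 (R134 N12 [B15] s2; the (ii) Theorems-side re-key of N12's road at print's [II] (2.3) datum — director-ym №338 ∕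
№343 (E1)(iii-b), FLAG №16 ∕ ruling (α); dag-n12-c DESIGN memo a793b2ebc0b803bf (ii); `N12-ROAD-TWIN-ORDER-2026-08-30.md`).  Count-neutral helper of K1⁹ `stmt-QuantumFields-27364`,
`--kind proof --supports … --as helper`.  THEOREMS ONLY (0 `def`, 0 `instance`, 0 `sorry`).

HONEST FRAMING (director-ym №338 (5)).  PURELY ADDITIVE: the parent stays landed and true on its own text; nothing in it is edited; no displayed premise of any consumer is deleted or
weakened; every hypothesis of the parent stays a hypothesis.  Nothing of Bałaban's analysis asserted; N12 NOT discharged; K0⁷ ∕ K1⁹ NOT closed; counts unmoved (typed 28∕28 · discharged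
8∕27, A 8∕28; K 1∕4); one finite 𝕋⁴ programme at fixed ε — R4 closes the conditional rung `BalabanLadder.UV` only; NOT the Yang–Mills mass gap (Clay); nothing continuum ∕ ℝ⁴ ∕ OS.

PARENT's DOCSTRING (the mathematics and the citations; read the site-level `𝐁` as the bond datum `𝔅`):
# BalabanUVNodes ∕ N12 — THE CLASS LETTER OF THE w1 LINEAGE's CHART THEOREM, PART 1: CONTINUITY OF THE AVERAGING OF RECORD IN THE CONFIGURATION
# DOWN THE BLOCK TOWER UNDER A CONSTRAINED BOND, AND THE (0.4) GUARDS THERE FROM THE LOCAL [B7] PROPOSITION 2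
# ([Balaban1987RG1] (0.4) p. 253 «we assume that it is an analytic function»; [Balaban1985Variational] (2), (7) pp. 278–279 «Ū^j ∈ U_{k−j}(…, O(1)ε₀)»;
# [Balaban1985Averaging] Prop. 2 (52)–(54) p. 26 «the result is local»)

Cell `pub-ymgap` (HUMAN RULINGS D-0062 ∕ D-0149), WIDTH SEAT `pub-ymgap-dag-n12-w1` g4 (node N12 = [B15]; key K1⁹ `stmt-QuantumFields-27364`, `--kind proof --supports … --as helper`;
count-neutral).  THEOREMS ONLY (0 `def`, 0 `instance`, 0 `sorry`); consumed BY NAME: dag-n07-e's one-bond continuity brick `…N07AveragingLocalContinuity.continuousAt_iter_succ_apply_of_small_of_local`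
(module 16, whose header defers exactly this composition: «iterated down the tower under a bond, with the smallness supplied … by the LOCAL Proposition 2 — not composed here»),
dag-n11-d's LOCAL `k`-uniform [B7] Prop. 2 `…N11LocalIteratedAveraging.plaqSmallOn_iter_avOfRecord_of_boxClosed`, and the tree's `BlockAveragingPlaquetteBoundLocal.small_of_plaqSmallOn_blocks`.

WHY.  The w1 lineage's chart theorems (`B15Prop1MinimiserFamilyFromThm1AtBaseCentral.hMin_atRecord_of_node00Letters_thm1AtBase_central`, p631475, and its (45)-discharged edition
`…N12RightInverseLetterOfForest.…_central_surj`, p633254) display, besides print's per-base-field letters, three CLASS letters about a closed reading class `reg'` of NODE 00's (2.12)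
class: `IsClosed reg'`, `closure (regMSCoPOfRecord …) ⊆ reg'`, and `hDreg' : ContinuousOn (fun U i => ↑(Ū U)_{(j_i,c_i)}) reg'` — the `𝐁`-restricted multi-scale averages are continuous
on `reg'`.  The third is NOT a formality: the averaging of record `blockAvg expMeanLogSU` is a total map extended by `1` off the (0.4) small-field guard and is DISCONTINUOUS there
(`BlockAveragingExpMeanLogContinuous`, header).  It is continuous in the configuration at `U₀` exactly where the guard holds down the block tower under the bond — THIS FILE, §1–§2 —
and the guard down the tower follows from print's regularity propagation [15] (7) ∕ [B7] Prop. 2 in its printed LOCAL form, which dag-n11-d typed for the averaging of record on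
box-closed plaquette families — §3.  Part 2 (`…N12ClassLettersAtClosedClassOfRecord`) feeds §3 from the closed (≤) reading of NODE 00's class and packages the three letters.

CONTENTS.
* §1 ★ `continuousAt_iter_apply_of_small_on_closedBelow` — TOWER CONTINUITY: for a bond family `B = (B_i)` closed downward under the (0.4) window below level `k` and a configuration
  `U₀` whose iterates carry the guard `Small ℰp (Ū^i U₀) c` at every `c ∈ B_{i+1}`, `i + 1 ≤ k`, EVERY tower variable `U ↦ Ū^i(U)(b)`, `i ≤ k`, `b ∈ B_i`, is continuous at `U₀`
  (induction on the level over dag-n07-e's brick); `continuousAt_iter_apply_of_smallBelow` — the global guard inhabits the hypotheses.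
* §2 ★★ `continuousOn_iter_apply_of_towerGuards`, ★★ `continuousOn_constrainedAverages_of_towerGuards` — `ContinuousOn` on ANY set `R` each of whose points carries such a tower (of
  height = the bond's level) under the bond, resp. under every constrained bond of a determining set `𝐁` up to level `k`; the second is VERBATIM the shape of the letter `hDreg'`
  (index `Fin (constrCard 𝐁 k)`, matrix values).
* §3 ★★ `small_iter_of_plaqSmallOn_boxClosed` — TOWER GUARDS from dag-n11-d's local Prop. 2: a box-closed plaquette family `S` containing the three blocks `B(c₋ − e_μ) ∪ B(c₋) ∪ B(c₊)`
  of every tower bond, `|U(∂p) − 1| < α₀η_k²` on `S 0`, and the numerics `C₀(d)α₀ ≤ ⅓`, `2α₀ ≤ c′₂` give the guard at every tower bond (the guard radius inequality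
  `(((d+2)L)²∕4)·2α₀ < δ_N` FOLLOWS from `2α₀ ≤ c′₂`, `stokes_two_mul_lt_deltaSU`); ★★★ `continuousAt_iter_apply_of_plaqSmallOn_boxClosed` — §1 ∘ §3.

HONEST FRAMING.  Kernel continuity∕bookkeeping over the tree's own averaging and dag-n11-d's kernel theorem ([B7] Prop. 2 local, proved in the tree); the box-closed ∕ window-closed
families and the fine plaquette bound are DISPLAYED hypotheses (Part 2 inhabits the bound from the class; the families are a combinatorial letter there); nothing of Bałaban's
estimates asserted; N12 NOT discharged; K1⁹ NOT closed; counts unmoved; one finite 𝕋⁴ programme at fixed ε — R4 closes the conditional rung `BalabanLadder.UV` only; the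
Yang–Mills mass gap (Clay) is NOT proved by any of this; nothing continuum ∕ ℝ⁴ ∕ OS.
-/

noncomputable section

namespace Summit.QuantumFields.YangMills.BalabanUVNodes.N12ClassLetterTowerContinuityB

open Literature.MathematicalPhysics.QuantumFieldTheory.Balaban1983to89.B15DeterminingSetsB

open Set Filter Topology
open Literature.MathematicalPhysics.QuantumFieldTheory.Balaban1983to89
open Literature.MathematicalPhysics.QuantumFieldTheory.Balaban1983to89.T4Continuum (T4Family)
open Literature.MathematicalPhysics.QuantumFieldTheory.Balaban1983to89.Node00
open Literature.MathematicalPhysics.QuantumFieldTheory.Balaban1983to89.BlockAveraging (blockAvg Small)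
open Literature.MathematicalPhysics.QuantumFieldTheory.Balaban1983to89.ExpMeanLog (expMeanLogSU deltaSU)
open Literature.MathematicalPhysics.QuantumFieldTheory.Balaban1983to89.B15DeterminingSets (DetSet MSField avgFamily bondsOf)
open Summit.QuantumFields.YangMills.BalabanUVNodes.N07AveragingLocalContinuity (continuousAt_iter_zero_apply continuousAt_iter_succ_apply_of_small_of_local)
open Summit.QuantumFields.YangMills.Theorems.BalabanUVNodesN11LocalIteratedAveraging (plaqSmallOn_iter_avOfRecord_of_boxClosed)
open Summit.QuantumFields.YangMills.BalabanUVNodes.N20LCSAvgDominationRegion (boxRegion)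
open Literature.MathematicalPhysics.QuantumFieldTheory.Balaban1983to89.BlockAveragingPlaquetteBoundLocal (small_of_plaqSmallOn_blocks)
open scoped Matrix.Norms.L2Operator
open Summit.QuantumFields.YangMills.BalabanUVNodes.N12ClassLetterTowerContinuity (continuousOn_iter_apply_of_towerGuards)

section
variable {F : T4Family} {N : ℕ} [NeZero N] {K : ℕ}

/-- ★★ **THE SHAPE OF THE CLASS LETTER `hDreg'`**: for a determining set `𝐁`, a top level `k` in the standing range, and a set `R` of configurations each of which carries,
under EVERY constrained bond `(j, c)` of `𝐁` with `j ≤ k`, a bond family through `c` closed downward under the (0.4) window below `j` and guarded below `j`, the `𝐁`-restricted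
averages `U ↦ (↑(Ū^{j_i}(U)(c_i)))_{i < #constraints}` (matrix values, NODE 00's enumeration `constrEnumB`) are continuous ON `R` — verbatim the hypothesis `hDreg'` of
`B15Prop1MinimiserFamilyFromThm1AtBaseCentral.hMin_atRecord_of_node00Letters_thm1AtBase_central` at `reg' := R`.
[cite: Balaban1985Variational, (2), (7) pp.278–279, (16)–(18) p.280; Balaban1988Convergent, (2.10)–(2.12) p.256] -/
theorem continuousOn_constrainedAverages_of_towerGuards {k : ℕ} (hk : k ≤ (F.P K).m + (F.P K).K) (𝔅 : BDetSet (F.P K))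
    (R : Set (GaugeField (F.P K) 0 (SU N)))
    (htower : ∀ U₀ ∈ R, ∀ j, j ≤ k → ∀ c ∈ (𝔅 j), ∃ B : (i : ℕ) → Set (PBond (F.P K) i), c ∈ B j ∧
      (∀ (i : ℕ) (c' : PBond (F.P K) (i + 1)), i + 1 ≤ j → c' ∈ B (i + 1) →
        ∀ b : PBond (F.P K) i, (blockOf b.src = c'.src ∨ blockOf b.src = c'.tgt) → b ∈ B i) ∧
      (∀ (i : ℕ) (c' : PBond (F.P K) (i + 1)), i + 1 ≤ j → c' ∈ B (i + 1) →
        Small (expMeanLogSU (n := Fin N)) (Averaging.iter (avOfRecord F N K) i U₀) c')) :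
    ContinuousOn (fun (U : GaugeField (F.P K) 0 (SU N)) (i : Fin (constrCardB 𝔅 k)) =>
      ((avgFamily (avOfRecord F N K) U ((constrEnumB 𝔅 k).symm i).1 ((constrEnumB 𝔅 k).symm i).2.1 : SU N) : Matrix (Fin N) (Fin N) ℂ)) R := by
  refine continuousOn_pi.2 fun i => ?_
  have hj : (((constrEnumB 𝔅 k).symm i).1 : ℕ) ≤ k := Nat.lt_succ_iff.mp ((constrEnumB 𝔅 k).symm i).1.2
  have h := continuousOn_iter_apply_of_towerGuards (hj.trans hk) R ((constrEnumB 𝔅 k).symm i).2.1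
    fun U₀ hU₀ => htower U₀ hU₀ _ hj _ ((constrEnumB 𝔅 k).symm i).2.2
  exact continuous_subtype_val.comp_continuousOn h

end

end Summit.QuantumFields.YangMills.BalabanUVNodes.N12ClassLetterTowerContinuityB

end
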